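/-
Origin: expansion seat `planner-pub-hodgecm-toy2-0`, handover #2 2026-08-18T03:32:46Z (`HOME/pub-hodgecm-toy2/lean/Models/Inhabited.lean`, md5 e83b674e, 125 lines);
landed by the gen-5 packager in gate run 18 as `HodgeCM/Model/Inhabited.lean` (import ^import Models\.→import HodgeCM.Model. ×1).
-/
/-
Copyright: pub-hodgecm formalisation cell (harness21, 2026). New file (not vendored).
Origin: HOME/pub-hodgecm-toy2/lean/Models/Inhabited.lean (WIP module `Models.Inhabited`; intended final place
`HodgeCM/Model/Inhabited.lean` = module `HodgeCM.Model.Inhabited`, CONTRIBUTING §3 L5) (seat planner-pub-hodgecm-toy2-0,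
consistency seat 2, part (6a)(i)/(ii): the hypotheses of the face statements are inhabited).
-/
import Summits.HodgeConjecture.HodgeCM.StubTree.Combinatorics
import Summits.HodgeConjecture.HodgeCM.Model.PeriodFree
import Mathlib.NumberTheory.Cyclotomic.PrimitiveRoots
import Mathlib.RingTheory.Polynomial.Cyclotomic.Roots

/-!
# The hypotheses of the face statements are inhabited: `ℚ(ζ₇)`

`HodgeCM.FaceHypothesesInhabited` (`∃ F` Galois CM with `[F:ℚ] ≥ 6`, a face `f` of `F`, an admissible `ι₁`) is
PROVED here (`faceHypothesesInhabited`), with the witness `F = ℚ(ζ₇) = CyclotomicField 7 ℚ` (CM by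
`IsCyclotomicExtension.Rat.isCMField`, Galois by `IsCyclotomicExtension.isGalois`, degree `φ(7) = 6` by
`IsCyclotomicExtension.finrank`), the STANDARD CM type (`stdCMType`: the distinguished embedding of every infinite
place), the face on any two distinct places (`exists_face`), and rfwf Lemma 2.1 (`StubTree.admissible_exists`) for
the admissible embedding.  Consequence (with `Models.PeriodFree`): for every universe `U` with `Fact_pull_hodge`,
`¬ U.periodFree.RealisationExistsFace` and `¬ U.periodFree.PeriodThmF` OUTRIGHT
(`not_realisationExistsFace_periodFree`, `not_periodThmF_periodFree`).

`HodgeCM.PerLHypothesesInhabited` is NOT proved in this package (it needs a non-Galois sextic CM field together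
with its Galois closure of degree 24 or 48 as a `CMField`, e.g. `K = K₀(√-β)`, `K₀ = ℚ(α)`, `α³ − 3α + 1 ≠ 0`
replaced by a non-cyclic cubic such as `x³ − 4x + 1` (discriminant 229, group `S₃`), `β = 1 + α²` say, closure
group `(ℤ/2)³ ⋊ S₃` of order 48; Mathlib has no ready normal-closure-is-CM API); it stays an explicit hypothesis
of the PerL-side non-vacuity theorems.
-/

noncomputable section

namespace HodgeCM

open Literature.AlgebraicGeometry.Motives (CMType)
open NumberField NumberField.InfinitePlace

/-! ### Every CM field has a CM type and (in degree ≥ 4) a face -/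

/-- The **standard CM type** of a CM field: the distinguished complex embedding `w.embedding` of each infinite
place `w` (a CM field is totally complex, so `w.embedding ≠ \overline{w.embedding}` and exactly one of the two
embeddings over `w` is chosen). -/
def stdCMType (K : CMField) : CMType K :=
  ⟨Set.range fun w : InfinitePlace K => w.embedding, fun φ => by
    constructor
    · rintro ⟨w, hw⟩ ⟨w', hw'⟩
      have h1 : w = mk φ := by rw [← hw, mk_embedding]
      have h2 : w' = mk φ := by rw [← mk_conjugate_eq, ← hw', mk_embedding]
      have h3 : ComplexEmbedding.conjugate φ = φ := by rw [← hw', h2, ← h1, hw]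
      exact IsTotallyComplex.complexEmbedding_not_isReal φ (ComplexEmbedding.isReal_iff.mpr h3)
    · intro h
      rcases embedding_mk_eq φ with h1 | h1
      · exact ⟨mk φ, h1⟩
      · exact absurd ⟨mk φ, h1⟩ h⟩

/-- A CM field of degree `≥ 6` (indeed `≥ 4`) has two distinct infinite places, hence a face (rfwf §1: a CM type
and two places `π ≠ π'`). -/
theorem exists_face (F : CMField) (h6 : 6 ≤ Module.finrank ℚ F) : Nonempty (Face F) := by
  classical
  have hcard : 1 < Fintype.card (InfinitePlace F) := by
    have h1 := InfinitePlace.card_eq_nrRealPlaces_add_nrComplexPlaces (K := F)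
    have h2 := IsTotallyComplex.finrank (K := F)
    have h3 := IsTotallyComplex.nrRealPlaces_eq_zero (K := F)
    omega
  obtain ⟨w, w', hww⟩ := Fintype.exists_pair_of_one_lt_card hcard
  exact ⟨{ Φ := stdCMType F, p := w.embedding, p' := w'.embedding,
           place_ne := by rwa [mk_embedding, mk_embedding] }⟩

/-- Face data with an admissible embedding exist over every CM field of degree `≥ 6` (rfwf Lemma 2.1,
`StubTree.admissible_exists`, applied to the face of `exists_face`). -/
theorem exists_face_admissible (F : CMField) (h6 : 6 ≤ Module.finrank ℚ F) :
    ∃ (f : Face F) (ι₁ : F →+* ℂ), f.Admissible ι₁ := by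
  obtain ⟨f⟩ := exists_face F h6
  obtain ⟨ι₁, h⟩ := StubTree.admissible_exists F h6 f
  exact ⟨f, ι₁, h⟩

/-! ### The seventh cyclotomic field -/

/- `IsCyclotomicExtension {7} ℚ (CyclotomicField 7 ℚ)` is registered for `CyclotomicField.instAlgebra`, while the
`ℚ`-algebra structure found on a bare `[Field K] [CharZero K]` is `DivisionRing.toRatAlgebra`; the two agree
definitionally but not at instance transparency — the same workaround as Mathlib's `fermatLastTheoremThree`. -/
set_option backward.isDefEq.respectTransparency false in
/-- (Ported verbatim from the HodgeCMPerL package; no docstring in the source.) -/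
instance cyclotomicField7_isCMField : IsCMField (CyclotomicField 7 ℚ) :=
  IsCyclotomicExtension.Rat.isCMField (CyclotomicField 7 ℚ) (S := ({7} : Set ℕ))
    ⟨7, Set.mem_singleton 7, by norm_num⟩

/-- `ℚ(ζ₇)` as a bundled CM field. -/
def cyclo7 : CMField := ⟨CyclotomicField 7 ℚ⟩

set_option backward.isDefEq.respectTransparency false in
/-- (Ported verbatim from the HodgeCMPerL package; no docstring in the source.) -/
theorem cyclo7_isGalois : IsGalois ℚ cyclo7 :=
  IsCyclotomicExtension.isGalois {7} ℚ (CyclotomicField 7 ℚ)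

set_option backward.isDefEq.respectTransparency false in
/-- (Ported verbatim from the HodgeCMPerL package; no docstring in the source.) -/
theorem cyclo7_finrank : Module.finrank ℚ cyclo7 = 6 := by
  have h := IsCyclotomicExtension.finrank (n := 7) (K := ℚ) (CyclotomicField 7 ℚ)
    (Polynomial.cyclotomic.irreducible_rat (by norm_num))
  rw [Nat.totient_prime (by norm_num : Nat.Prime 7)] at h
  exact h

/-- **The face hypotheses are inhabited** (`F = ℚ(ζ₇)`). -/
theorem faceHypothesesInhabited : FaceHypothesesInhabited := by
  obtain ⟨f, ι₁, h⟩ := exists_face_admissible cyclo7 (by rw [cyclo7_finrank])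
  exact ⟨cyclo7, cyclo7_isGalois, by rw [cyclo7_finrank], f, ι₁, h⟩

/-! ### Outright refutations in the period-free shadow -/

namespace Universe

variable (U : Universe)

/-- For every universe with `Fact_pull_hodge`, the open input `RealisationExistsFace` FAILS in its period-free
shadow. -/
theorem not_realisationExistsFace_periodFree (hH : U.Fact_pull_hodge) : ¬ U.periodFree.RealisationExistsFace :=
  fun h => (U.periodFree_realisationExistsFace_iff hH).mp h faceHypothesesInhabited

/-- For every universe, rfwf Thm 4.1 (admissible form) FAILS in its period-free shadow. -/
theorem not_periodThmF_periodFree : ¬ U.periodFree.PeriodThmF :=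
  fun h => U.periodFree_periodThmF_iff.mp h faceHypothesesInhabited

end Universe

end HodgeCM

end
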